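import Literature.AlgebraicGeometry.ComplexMultiplication.CMAlgebraDegreeLeEightFamiliesHodge
import Literature.AlgebraicGeometry.ComplexMultiplication.SimpleCMSurfaceTimesThreefoldHodge
import Literature.AlgebraicGeometry.ComplexMultiplication.QuadraticCMFieldPairwiseForeignFamiliesHodge
import Literature.AlgebraicGeometry.ComplexMultiplication.QuadraticCMFieldTwoSlotFamilies
import Literature.AlgebraicGeometry.ComplexMultiplication.QuadraticCMFieldFamiliesSeparating
import Literature.AlgebraicGeometry.ComplexMultiplication.CMAbelianVarietyRealisedHolds
import Literature.NumberTheory.ComplexMultiplication.ShimuraTaniyamaHecke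
import Mathlib.LinearAlgebra.FiniteDimensional.Lemmas
import Literature.AlgebraicGeometry.Motives.AbelianVarietyEndAlgebraIsogenyInvariance
import Literature.AlgebraicGeometry.Milne1999.CMTypeNonzeroHom
import Literature.AlgebraicGeometry.ComplexMultiplication.AndreRiemannDecomposition
import HarnessLib

/-!
# Moonen–Zarhin 1999 Thms. 0.1 (4) and 0.2 (4), CM case — MASTER FORMS: a complex abelian variety of CM type of dimension
# `≤ 5` outside cases (a⁺)/(b) is STABLY divisor-generated (`B = D` on everything dominated by a power); case (a) forces an
# exceptional class; the non-simple CM fourfold dichotomy; `End⁰(A) ≅ K` for a simple principal CM realisation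

(Part 1) The MAIN CRITERION in total dimension `≤ 5` (`isNondegenerateFamily_iff_of_isSimple_of_sum_dim_le_five`: simple,
pairwise non-isogenous CM realisations outside (a⁺) «curve field inside a sextic or octic member field» and (b) are a
nondegenerate family) and `Bᵐ ⊗ ℂ = Dᵐ ⊗ ℂ` on all their products. (Part 2) `End⁰(A) ≅ K` for a SIMPLE principal
realisation `(A, ι, θ)` of a CM type `(K; Φ)` (Shimura §5.1 Props. 3, 4, 6; Serre–Tate). (Part 3) `B ≼ B × C`.
(Part 4) Domination bookkeeping (`F j ≼ ⨁ F`, `C ≼ B × C`, both maps of a domination of a positive-dimensional `A` are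
non-zero), UNIQUENESS OF THE SIMPLE ISOGENY FACTORS (Mumford §19 Cor. 1: a simple isogeny factor of `⨁_j F_j` with simple
`F_j` is isogenous to some `F_j`), Moonen–Zarhin's case (a) FORCES an exceptional class in `H⁴` of a CM fourfold
(`exists_exceptional_two_of_curve_threefold_factors`, `not_isDivisorGenerated_of_curve_threefold_factors`), and the MASTER FORM
for CM FOURFOLDS: divisor-generated ⟹ stably divisor-generated (`isDivisorGenerated_of_avDominatedBy_powSucc_of_isOfCMType_of_dim_four`).
(Part 5) A NON-SIMPLE CM fourfold is divisor-generated iff it is outside case (a)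
(`isDivisorGenerated_iff_of_not_isSimple_of_dim_four`). (Part 6) The MASTER FORM in dimension `≤ 5`
(`isDivisorGenerated_of_avDominatedBy_powSucc_of_isOfCMType_of_dim_le_five`: outside (a⁺)/(b), everything dominated by a power
`X^{N+1}` is divisor-generated). Nothing here asserts a case of the Hodge conjecture beyond `B = D` statements.

* Part 1 — from `CorCM/CMAlgebraDegreeLeTenFamilies` (2/5 declarations; namespace
  `Literature.AlgebraicGeometry.ComplexMultiplication`): Simple, pairwise non-isogenous CM abelian varieties of total
  dimension `≤ 5`: the product is stably nondegenerate. Declarations: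
  `isNondegenerateFamily_iff_of_isSimple_of_sum_dim_le_five`,
  `hodgeClassSpan_prod_eq_divisorClassesSpan_of_sum_dim_le_five`.
* Part 2 — from `HodgeConjecture/Theorems/Ring2AtlasUnitaryThreefoldPairNonVacuity` (1/18 declarations; namespace
  `Literature.AlgebraicGeometry.ComplexMultiplication.CMAtlas`): Ring 2 · atlas-2 — the OPEN `Y₃ × Y₃'` cell is NOT
  VACUOUS on its CM locus. Declarations: `nonempty_ringEquiv_endAlgebra_of_isSimple`.
* Part 3 — from `CorCM/CMProductSimpleFactors` (1/14 declarations; namespace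
  `Literature.AlgebraicGeometry.ComplexMultiplication.SliceExhaustion`): Simple isogeny factors of `∏_j A_{(F,Θ_j)}`
  have `End⁰ →+* F` — the binder-language slices of `HC_CM` ARE its. Declarations: `avDominatedBy_prod_left`.
* Part 4 — from `CorCM/CMAbelianFourfoldPowers` (7/15 declarations; namespace
  `Literature.AlgebraicGeometry.ComplexMultiplication`): Complex abelian FOURFOLDS of CM type: `B•(X) = D•(X)` iff all
  powers are divisor-generated iff `X` is neither. Declarations: `avDominatedBy_biproduct_summand`,
  `avDominatedBy_prod_right`, `ne_zero_of_comp_eq_nsmul_id`,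
  `exists_isIsogenous_of_isSimple_of_avDominatedBy_biproduct`, `exists_exceptional_two_of_curve_threefold_factors`,
  `not_isDivisorGenerated_of_curve_threefold_factors`,
  `isDivisorGenerated_of_avDominatedBy_powSucc_of_isOfCMType_of_dim_four`.
* Part 5 — from `CorCM/CMAbelianFourfoldClassification` (1/6 declarations; namespace
  `Literature.AlgebraicGeometry.ComplexMultiplication`): Complex abelian FOURFOLDS of CM type: the classification
  `B•(X) = D•(X) ⟺ ¬(a) ∧ ¬(b)` and the dichotomy. Declarations: `isDivisorGenerated_iff_of_not_isSimple_of_dim_four`.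
* Part 6 — from `CorCM/CMAbelianFivefoldPowers` (1/8 declarations; namespace
  `Literature.AlgebraicGeometry.ComplexMultiplication`): Complex abelian varieties of CM type of dimension `≤ 5`: all
  powers are divisor-generated iff no elliptic-curve. Declarations:
  `isDivisorGenerated_of_avDominatedBy_powSucc_of_isOfCMType_of_dim_le_five`.

## References

* [MoonenZarhin1999LowDim] B. Moonen, Yu. Zarhin, *Hodge classes on abelian varieties of low dimension*, Math. Ann.
  315 (1999) 711–733, Thm. (0.2) (e)–(g), (1)–(4); §5.
* [Gordon1999HodgeAVSurvey] B. B. Gordon, *A survey of the Hodge conjecture for abelian varieties*, §3 Theorem,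
  7.4–7.7, 9.2, 10.10.
* [Yanai1985] H. Yanai, Nagoya Math. J. 97 (1985), §4 Theorem; [Ribet1980] K. Ribet, §3 (3.7).
* [Shimura1998] G. Shimura, *Abelian Varieties with Complex Multiplication and Modular Functions*, Princeton Univ.
  Press (1998), §5.1 Props. 3, 4, 6, §8.2 Prop. 26, §8.4 Example (1).
* [SerreTate1968] J.-P. Serre, J. Tate, *Good reduction of abelian varieties*, Ann. of Math. 88 (1968), §4.
* [MumfordAV1970] D. Mumford, *Abelian Varieties* (1970), §19 Cor. 1–2 of Thm. 3 and pp. 172–174.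
* [Milne1999] J. S. Milne, *Lefschetz motives and the Tate conjecture*, Compositio Math. 117 (1999), §2 p. 54.
* [MoonenZarhin1999] B. Moonen, Yu. Zarhin, Duke Math. J. 97 (1999), Thm. 0.1 (iv) and §6.
* [Streng2010] M. Streng, thesis (2010), Ch. I Def. 3.2, Lemma 3.5.
* [Milne1999LefschetzClasses] J. S. Milne, Duke Math. J. 96 (1999), §1 Prop. 1.1; [Shimura1998] G. Shimura, §5.1
  Props. 3–6, §8.2 Prop. 26.

Provenance: Literature home of the used declarations of the Summits-side modules listed part by part above (cells
`pub-hodge-ring2` / `pub-hodgecm2`; namespaces `Summit.HodgeConjecture.CorCM`,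
`Summit.HodgeConjecture.CorCM.SliceExhaustion`, `Summit.HodgeConjecture.HodgeConjecture.Ring2.Atlas` re-rooted under
`Literature.AlgebraicGeometry.…` as stated), whose imports are `Literature/` and Mathlib only for the declarations
used; re-homed verbatim (proofs unchanged) so that Literature users are served without importing `Summits/`. Lane
`lit-hodgefound`, seat p20 (generation 34). Theorems only: no definition, no named fact, no `sorry`; axioms `propext`,
`Classical.choice`, `Quot.sound`.
-/

/-! ## Part 1: CMAlgebraDegreeLeTenFamilies -/

noncomputable section

open _root_.CategoryTheory _root_.CategoryTheory.Limits NumberField NumberField.ComplexEmbedding IntermediateField Module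
open scoped BigOperators

namespace Literature.AlgebraicGeometry.ComplexMultiplication

open Literature.AlgebraicGeometry.ComplexMultiplication.Domination

open Literature.NumberTheory.ComplexMultiplication
open Literature.AlgebraicGeometry.Motives (AbelianVariety CMType)
open Literature.AlgebraicGeometry.Motives.AbelianVariety
open Literature.AlgebraicGeometry.HodgeTheory
open Literature.AlgebraicGeometry.ComplexMultiplication (IsCMTypeRealisation)
open Literature.AlgebraicGeometry.VanGeemen1994 (hodgeClassSpan)
open Literature.AlgebraicGeometry.Pohlmann1968
open Literature.Barriers.HodgeConjecture (divisorClassesSpan)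

section Criterion

variable {I : Type} {K : I → Type} [∀ i, Field (K i)] [∀ i, NumberField (K i)] [∀ i, IsCMField (K i)] [Fintype I]
  [DecidableEq I] [Nonempty I] {Φ : ∀ i, CMType (K i)}
variable {A : I → AbelianVariety ℂ} {ι : ∀ i, 𝓞 (K i) →+* End (A i)}
  {θ : ∀ i, K i →+* Module.End ℂ (complexBetti (A i).X 1)}

/-- **MAIN CRITERION (Moonen–Zarhin (0.2), CM case, on CM types).**  Let `A_i` (`i ∈ I`) be SIMPLE, PAIRWISE
NON-ISOGENOUS complex abelian varieties with complex multiplication — realisations of CM types `(K_i; Φ_i)` on `H¹` —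
of total dimension `Σ_i dim A_i ≤ 5`.  Then the family `(Φ_i)_i` is nondegenerate (`rank Hg(∏_i A_i) = Σ_i dim A_i`)
iff (¬a⁺) for all slots `a ≠ b` with `dim A_a = 1` and `dim A_b ∈ {3, 4}` the imaginary quadratic field `K_a` does NOT
embed in `K_b`, and (¬b) for every slot with `dim A_b = 4` the type `Φ_b` is nondegenerate.  Proof by the dimension
multiset: all curves; one slot of dimension `≥ 2` and curves (seat b16 gen 37's single-big-slot criterion; dimension
`2`: Ribet and no embedded quadratic field; `3`: Ribet; `4`: as stated; `5`: Yanai, alone); two slots of dimensions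
`(2,3)` (always nondegenerate, SURF-T3) or `(2,2)` with at most one curve (file F4).
[cite: MoonenZarhin1999LowDim, Thm. (0.2) (1)–(4) and §5] [cite: Gordon1999HodgeAVSurvey, 7.4–7.5]
[cite: Yanai1985, §4 Theorem] [cite: Ribet1980, §3 (3.7)] -/
theorem isNondegenerateFamily_iff_of_isSimple_of_sum_dim_le_five
    (hA : ∀ i, IsCMTypeRealisation (Φ i) (A i) (ι i) (θ i)) (hs : ∀ i, (A i).IsSimple)
    (hniso : ∀ i j, i ≠ j → ¬ AbelianVariety.IsIsogenous (A i) (A j)) (h5 : ∑ i, (A i).dim ≤ 5) :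
    CMAlgebra.IsNondegenerateFamily Φ ↔
      (∀ a b, a ≠ b → (A a).dim = 1 → ((A b).dim = 3 ∨ (A b).dim = 4) → IsEmpty (K a →+* K b)) ∧
        ∀ b, (A b).dim = 4 → IsNondegenerate (Φ b) := by
  classical
  have hsep := CMAlgebra.isSeparatingFamily_of_isSimple_of_pairwise_not_isIsogenous hA hs hniso
  have hdeg : ∀ i, finrank ℚ (K i) = 2 * (A i).dim := finrank_eq_two_mul_dim hA
  have hpos : ∀ i, 0 < (A i).dim := fun i => by
    have h := Module.finrank_pos (R := ℚ) (M := K i)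
    rw [hdeg i] at h
    omega
  have hle : ∀ i, (A i).dim ≤ ∑ j, (A j).dim := fun i =>
    Finset.single_le_sum (fun j _ => Nat.zero_le ((A j).dim)) (Finset.mem_univ i)
  -- bookkeeping: two, resp. three, distinct slots have total dimension at most the sum
  have hsum2 : ∀ {i j : I}, i ≠ j → (A i).dim + (A j).dim ≤ ∑ k, (A k).dim := by
    intro i j h
    have h1 := Finset.add_sum_erase Finset.univ (fun k => (A k).dim) (Finset.mem_univ i)
    have h2 : (A j).dim ≤ ∑ k ∈ Finset.univ.erase i, (A k).dim :=
      Finset.single_le_sum (fun k _ => Nat.zero_le ((A k).dim)) (Finset.mem_erase.2 ⟨h.symm, Finset.mem_univ j⟩)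
    omega
  have hsum3 : ∀ {i j l : I}, i ≠ j → i ≠ l → j ≠ l → (A i).dim + (A j).dim + (A l).dim ≤ ∑ k, (A k).dim := by
    intro i j l hij hil hjl
    have h1 := Finset.add_sum_erase Finset.univ (fun k => (A k).dim) (Finset.mem_univ i)
    have h2 := Finset.add_sum_erase (Finset.univ.erase i) (fun k => (A k).dim)
      (Finset.mem_erase.2 ⟨hij.symm, Finset.mem_univ j⟩)
    have h3 : (A l).dim ≤ ∑ k ∈ (Finset.univ.erase i).erase j, (A k).dim :=
      Finset.single_le_sum (fun k _ => Nat.zero_le ((A k).dim))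
        (Finset.mem_erase.2 ⟨hjl.symm, Finset.mem_erase.2 ⟨hil.symm, Finset.mem_univ l⟩⟩)
    omega
  by_cases hall : ∀ i, (A i).dim = 1
  · -- all slots are CM elliptic curves with pairwise non-isomorphic fields
    have h2 : ∀ i, finrank ℚ (K i) = 2 := fun i => by rw [hdeg, hall]
    exact ⟨fun _ => ⟨fun a b _ _ hb => by have := hall b; omega, fun b hb => by have := hall b; omega⟩,
      fun _ => isNondegenerateFamily_of_finrank_eq_two h2 hsep⟩
  push Not at hall
  obtain ⟨i₁, hi₁⟩ := hall
  have hi₁2 : 2 ≤ (A i₁).dim := by have := hpos i₁; omega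
  obtain ⟨φ₁⟩ : Nonempty (K i₁ →+* ℂ) := inferInstance
  have hprim₁ : IsPrimitive (ℂ ≃+* ℂ) (Φ i₁).1 φ₁ := hsep.isPrimitive i₁ φ₁
  by_cases huniq : ∀ j, j ≠ i₁ → (A j).dim = 1
  · -- `i₁` is the only slot of dimension `≥ 2`
    have h2 : ∀ j, j ≠ i₁ → finrank ℚ (K j) = 2 := fun j hj => by rw [hdeg, huniq j hj]
    have hχ := exists_not_iff_of_isSeparatingFamily (fun i => i = i₁) Φ h2
      (isSeparatingFamily_subtype hsep fun j => j ≠ i₁)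
    rw [isNondegenerateFamily_iff_forall_isEmpty_single i₁ Φ h2 hχ]
    -- off `i₁` the dimension-`3`/`4` clause is void
    have hoff : ∀ b, b ≠ i₁ → ¬ ((A b).dim = 3 ∨ (A b).dim = 4) := fun b hb h => by have := huniq b hb; omega
    have hoff4 : ∀ b, b ≠ i₁ → (A b).dim ≠ 4 := fun b hb h => by have := huniq b hb; omega
    rcases (show (A i₁).dim = 2 ∨ (A i₁).dim = 3 ∨ (A i₁).dim = 4 ∨ (A i₁).dim = 5 by
        have := hle i₁; omega) with hd | hd | hd | hd
    · -- a quartic slot and curves: both sides hold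
      have h4K : finrank ℚ (K i₁) = 4 := by rw [hdeg, hd]
      have hnd : IsNondegenerate (Φ i₁) := isNondegenerate_of_isPrimitive_of_finrank_le_six (Φ i₁) (by omega) φ₁ hprim₁
      have hemp : ∀ a, a ≠ i₁ → IsEmpty (K a →+* K i₁) := fun a ha =>
        isEmpty_ringHom_of_finrank_eq_two_of_isPrimitive_quartic Φ (h2 a ha) h4K hprim₁
      refine ⟨fun _ => ⟨fun a b _ _ hb => ?_, fun b hb => ?_⟩, fun _ => ⟨hnd, hemp⟩⟩
      · exfalso
        by_cases hb1 : b = i₁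
        · rw [hb1] at hb; omega
        · exact hoff b hb1 hb
      · exfalso
        by_cases hb1 : b = i₁
        · rw [hb1] at hb; omega
        · exact hoff4 b hb1 hb
    · -- a sextic slot and curves
      have hnd : IsNondegenerate (Φ i₁) :=
        isNondegenerate_of_isPrimitive_of_finrank_le_six (Φ i₁) (by rw [hdeg, hd]) φ₁ hprim₁
      refine ⟨fun h => ⟨fun a b hab _ hb => ?_, fun b hb => ?_⟩,
        fun h => ⟨hnd, fun a ha => h.1 a i₁ ha (huniq a ha) (Or.inl hd)⟩⟩
      · have hb1 : b = i₁ := by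
          by_contra hb1
          exact hoff b hb1 hb
        subst hb1
        exact h.2 a hab
      · exfalso
        by_cases hb1 : b = i₁
        · rw [hb1] at hb; omega
        · exact hoff4 b hb1 hb
    · -- an octic slot and (at most one) curve
      refine ⟨fun h => ⟨fun a b hab _ hb => ?_, fun b hb => ?_⟩,
        fun h => ⟨h.2 i₁ hd, fun a ha => h.1 a i₁ ha (huniq a ha) (Or.inr hd)⟩⟩
      · have hb1 : b = i₁ := by
          by_contra hb1
          exact hoff b hb1 hb
        subst hb1
        exact h.2 a hab
      · have hb1 : b = i₁ := by
          by_contra hb1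
          exact hoff4 b hb1 hb
        subst hb1
        exact h.1
    · -- a slot of dimension `5` (degree `10`, Yanai): it is alone
      have hsub : ∀ j, j = i₁ := fun j => by
        by_contra hj
        have h₁ := hsum2 hj
        have h₂ := huniq j hj
        omega
      have hnd : IsNondegenerate (Φ i₁) :=
        isNondegenerate_of_isPrimitive_of_prime (by norm_num : Nat.Prime 5) (by rw [hdeg, hd]) φ₁ hprim₁
      refine ⟨fun _ => ⟨fun a b hab _ _ => (hab ((hsub a).trans (hsub b).symm)).elim, fun b hb => ?_⟩,
        fun _ => ⟨hnd, fun a ha => (ha (hsub a)).elim⟩⟩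
      obtain rfl := hsub b
      omega
  · -- a second slot `i₀ ≠ i₁` of dimension `≥ 2`; every further slot is a curve
    push Not at huniq
    obtain ⟨i₀, hi₀, hi₀1⟩ := huniq
    have hi₀2 : 2 ≤ (A i₀).dim := by have := hpos i₀; omega
    have h01 := hsum2 hi₀
    have hrest : ∀ j, j ≠ i₀ → j ≠ i₁ → (A j).dim = 1 := fun j hj₀ hj₁ => by
      have h₃ := hsum3 hj₀ hj₁ hi₀
      have := hpos j
      omega
    -- the right-hand side is void: no slot of dimension `3` or `4` next to a curve… unless `(2,3)` without curves
    by_cases h23 : (A i₀).dim + (A i₁).dim = 5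
    · -- dimensions `(2,3)` or `(3,2)`: no curve fits; SURF-T3
      have hI : ∀ j, j = i₀ ∨ j = i₁ := fun j => by
        by_contra hj
        push Not at hj
        have h₃ := hsum3 hj.1 hj.2 hi₀
        have := hpos j
        omega
      have hnd : CMAlgebra.IsNondegenerateFamily Φ := by
        rcases (show (A i₀).dim = 2 ∨ (A i₁).dim = 2 by omega) with hd | hd
        · exact isNondegenerateFamily_simpleSurface_simpleThreefold hi₀ hI (by rw [hdeg, hd]) (by rw [hdeg]; omega)
            hA (hs i₀) (hs i₁)
        · exact isNondegenerateFamily_simpleSurface_simpleThreefold (Ne.symm hi₀) (fun j => (hI j).symm)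
            (by rw [hdeg, hd]) (by rw [hdeg]; omega) hA (hs i₁) (hs i₀)
      refine ⟨fun _ => ⟨fun a b _ ha _ => ?_, fun b hb => ?_⟩, fun _ => hnd⟩
      · exfalso; rcases hI a with rfl | rfl <;> omega
      · exfalso; rcases hI b with rfl | rfl <;> omega
    · -- dimensions `(2,2)` and at most one curve: file F4
      have hd₀ : (A i₀).dim = 2 := by omega
      have hd₁ : (A i₁).dim = 2 := by omega
      let p : I → Prop := fun i => i = i₀ ∨ i = i₁
      have h2 : ∀ j, ¬p j → finrank ℚ (K j) = 2 := fun j hj => by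
        have hj' : j ≠ i₀ ∧ j ≠ i₁ := not_or.1 hj
        rw [hdeg, hrest j hj'.1 hj'.2]
      have hnd : CMAlgebra.IsNondegenerateFamily Φ :=
        isNondegenerateFamily_curves_simpleSurfaces p hi₀ (fun _ => Iff.rfl) (by rw [hdeg, hd₀]) (by rw [hdeg, hd₁])
          h2 hA (hs i₀) (hs i₁) (hniso i₀ i₁ hi₀) (isSeparatingFamily_subtype hsep fun j => ¬p j)
      refine ⟨fun _ => ⟨fun a b _ _ hb => ?_, fun b hb => ?_⟩, fun _ => hnd⟩
      · exfalso
        by_cases hb₀ : b = i₀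
        · rw [hb₀] at hb; omega
        by_cases hb₁ : b = i₁
        · rw [hb₁] at hb; omega
        have := hrest b hb₀ hb₁; omega
      · exfalso
        by_cases hb₀ : b = i₀
        · rw [hb₀] at hb; omega
        by_cases hb₁ : b = i₁
        · rw [hb₁] at hb; omega
        have := hrest b hb₀ hb₁; omega

end Criterion

/-! ## Hodge classes on the products -/

section Geometry

variable {I : Type} {K : I → Type} [∀ i, Field (K i)] [∀ i, NumberField (K i)] [∀ i, IsCMField (K i)] [Fintype I]
  [DecidableEq I] [Nonempty I] {Φ : ∀ i, CMType (K i)}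
variable {A : I → AbelianVariety ℂ} {ι : ∀ i, 𝓞 (K i) →+* End (A i)}
  {θ : ∀ i, K i →+* Module.End ℂ (complexBetti (A i).X 1)}

/-- **`Bᵐ ⊗ ℂ = Dᵐ ⊗ ℂ` on every `∏_i A_i^{k_i}`** for simple, pairwise non-isogenous CM abelian varieties of total
dimension `≤ 5` satisfying (¬a⁺) ∧ (¬b) (Moonen–Zarhin (0.2) (4), CM case). [cite: MoonenZarhin1999LowDim, Thm. (0.2) (4)]
[cite: Gordon1999HodgeAVSurvey, 7.5] -/
theorem hodgeClassSpan_prod_eq_divisorClassesSpan_of_sum_dim_le_five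
    (hA : ∀ i, IsCMTypeRealisation (Φ i) (A i) (ι i) (θ i)) (hs : ∀ i, (A i).IsSimple)
    (hniso : ∀ i j, i ≠ j → ¬ AbelianVariety.IsIsogenous (A i) (A j)) (h5 : ∑ i, (A i).dim ≤ 5)
    (hfor : ∀ a b, a ≠ b → (A a).dim = 1 → ((A b).dim = 3 ∨ (A b).dim = 4) → IsEmpty (K a →+* K b))
    (hoct : ∀ b, (A b).dim = 4 → IsNondegenerate (Φ b)) {N : ℕ} (π : Fin N → I) (m : ℕ) :
    hodgeClassSpan (⨁ fun j : Fin N => A (π j)).dim (⨁ fun j : Fin N => A (π j)).X m =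
      divisorClassesSpan (⨁ fun j : Fin N => A (π j)).X (⨁ fun j : Fin N => A (π j)).dim m :=
  ((isNondegenerateFamily_iff_of_isSimple_of_sum_dim_le_five hA hs hniso h5).2 ⟨hfor, hoct⟩)
    |>.hodgeClassSpan_prod_eq_divisorClassesSpan hA π m

end Geometry

end Literature.AlgebraicGeometry.ComplexMultiplication

end

/-! ## Part 2: Ring2AtlasUnitaryThreefoldPairNonVacuity -/

noncomputable section

open Polynomial NumberField _root_.CategoryTheory

namespace Literature.AlgebraicGeometry.ComplexMultiplication.CMAtlas

open Literature.AlgebraicGeometry Literature.AlgebraicGeometry.Motives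
open Literature.AlgebraicGeometry.HodgeTheory (complexBetti)
open Literature.AlgebraicGeometry.ComplexMultiplication
open Literature.NumberTheory.ComplexMultiplication
open Literature.AlgebraicGeometry.Pohlmann1968 (finrank_eq_two_mul_dim_of_isCMTypeRealisation)

/-! ## §1 `End⁰ = K` for a simple principal realisation; isogenous realisations have comparable CM fields -/

section EndAlgebra

variable {K : Type} [Field K] [NumberField K] {Φ : CMType K}
  {A : AbelianVariety ℂ} {ι : 𝓞 K →+* End A} {θ : K →+* Module.End ℂ (complexBetti A.X 1)}
variable {K' : Type} [Field K'] [NumberField K'] {Φ' : CMType K'}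
  {A' : AbelianVariety ℂ} {ι' : 𝓞 K' →+* End A'} {θ' : K' →+* Module.End ℂ (complexBetti A'.X 1)}

/-- **`End⁰(A) ≅ K` for a SIMPLE principal realisation `(A, ι, θ)` of a CM type `(K; Φ)`** (Shimura §5.1
Props. 3, 4, 6: «the commutor of `F` in `End_ℚ(A)` coincides with `F`», «`End_ℚ(B) = K`»): the Serre–Tate map
`i : K → End⁰(A)` extending `ι` (`exists_ringHom_endAlgebra`) is injective (a ring map out of a field) and
`End⁰(A)` is a field of degree `2 dim A = [K : ℚ]` (`Milne1999.IsOfCMType.isOfCMTypeSimple`,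
`Pohlmann1968.finrank_eq_two_mul_dim_of_isCMTypeRealisation`, `AbelianVariety.finiteDimensional_endAlgebra_holds`),
so `i` is bijective by the dimension count. Code pattern of `CorCM.CMSixfoldRank.…Degenerate` §1.
[cite: Shimura1998, §5.1 Props. 3, 4, 6] [cite: SerreTate1968, §4] [cite: Milne1999, §2 p. 54] -/
theorem nonempty_ringEquiv_endAlgebra_of_isSimple (hA : IsCMTypeRealisation Φ A ι θ) (hs : A.IsSimple) :
    Nonempty (K ≃+* A.endAlgebra) := by
  obtain ⟨i, -⟩ := exists_ringHom_endAlgebra (A₀ := A) ι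
  have hK2 : Module.finrank ℚ K = 2 * A.dim := finrank_eq_two_mul_dim_of_isCMTypeRealisation hA
  have hpos : 0 < A.dim := by
    have h : 0 < Module.finrank ℚ K := Module.finrank_pos
    omega
  obtain ⟨hF, hrk⟩ := (isOfCMType_of_isCMTypeRealisation hA).isOfCMTypeSimple hs hpos
  haveI : Nontrivial A.endAlgebra := ⟨hF.exists_pair_ne⟩
  have hinj : Function.Injective i := i.injective
  have heq : Module.finrank ℚ K = Module.finrank ℚ A.endAlgebra := by rw [hrk, hK2]
  have hfin : Module.Finite ℚ A.endAlgebra := AbelianVariety.finiteDimensional_endAlgebra_holds A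
  -- (`Module ℚ End⁰(A)` is found only through `Algebra ℚ End⁰(A)`: instances passed explicitly)
  have hsurj : Function.Surjective i :=
    (@LinearMap.injective_iff_surjective_of_finrank_eq_finrank ℚ K _ _ _ A.endAlgebra _
      Algebra.toModule _ hfin heq i.toRatAlgHom.toLinearMap).1 hinj
  exact ⟨RingEquiv.ofBijective i ⟨hinj, hsurj⟩⟩

end EndAlgebra

end Literature.AlgebraicGeometry.ComplexMultiplication.CMAtlas

end

/-! ## Part 3: CMProductSimpleFactors -/

noncomputable section

open _root_.CategoryTheory _root_.CategoryTheory.Limits NumberField _root_.AlgebraicGeometry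
open Literature.AlgebraicGeometry Literature.AlgebraicGeometry.Motives Literature.AlgebraicGeometry.HodgeTheory
open Literature.AlgebraicGeometry.ComplexMultiplication Literature.AlgebraicGeometry.Milne1999
open Literature.AlgebraicGeometry.ComplexMultiplication.Domination

namespace Literature.AlgebraicGeometry.ComplexMultiplication.SliceExhaustion

/-! ## §1 The primitive core of a CM type -/

variable {F : Type} [Field F] [NumberField F] [IsCMField F]

/-- A factor of a binary product is dominated by it: `B ≼ B × C`. [cite: MumfordAV1970, §19] -/
theorem avDominatedBy_prod_left (B C : AbelianVariety ℂ) : AVDominatedBy B (B.prod C) :=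
  ⟨biprod.inl ≫ (AbelianVariety.biprodIsoProd B C).hom, (AbelianVariety.biprodIsoProd B C).inv ≫ biprod.fst, 1,
    one_ne_zero, by rw [Category.assoc, (AbelianVariety.biprodIsoProd B C).hom_inv_id_assoc, biprod.inl_fst, one_smul]⟩

end Literature.AlgebraicGeometry.ComplexMultiplication.SliceExhaustion

end

/-! ## Part 4: CMAbelianFourfoldPowers -/

noncomputable section

open _root_.CategoryTheory _root_.CategoryTheory.Limits NumberField
open scoped BigOperators

namespace Literature.AlgebraicGeometry.ComplexMultiplication

open Literature.NumberTheory.ComplexMultiplication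
open Literature.AlgebraicGeometry.Motives (AbelianVariety)
open Literature.AlgebraicGeometry.Motives.AbelianVariety
open Literature.AlgebraicGeometry.HodgeTheory
open Literature.AlgebraicGeometry.ComplexMultiplication
open Literature.AlgebraicGeometry.Milne1999
open Literature.AlgebraicGeometry.Pohlmann1968
open Literature.Barriers.HodgeConjecture (divisorClassesSpan)
open Literature.AlgebraicGeometry.ComplexMultiplication.Domination
open Literature.AlgebraicGeometry.ComplexMultiplication.CMAtlas (nonempty_ringEquiv_endAlgebra_of_isSimple)

/-! ## §1 Isogeny factors: summands, products, and uniqueness of the simple factors -/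

section Factors

/-- A summand of a biproduct is an isogeny factor of it: `F j ≼ ⨁ F` (`ι_j ≫ π_j = 𝟙`). [cite: MumfordAV1970, §19] -/
theorem avDominatedBy_biproduct_summand {J : Type} [Fintype J] (F : J → AbelianVariety ℂ) (j : J) :
    AVDominatedBy (F j) (⨁ F) := by
  classical
  exact ⟨biproduct.ι F j, biproduct.π F j, 1, one_ne_zero, by rw [biproduct.ι_π_self, one_smul]⟩

/-- The second factor of a binary product is dominated by it: `C ≼ B × C` (companion of
`SliceExhaustion.avDominatedBy_prod_left`). [cite: MumfordAV1970, §19] -/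
theorem avDominatedBy_prod_right (B C : AbelianVariety ℂ) : AVDominatedBy C (B.prod C) :=
  ⟨AbelianVariety.prodLift 0 (𝟙 C), AbelianVariety.snd B C, 1, one_ne_zero, by
    rw [AbelianVariety.prodLift_snd, one_smul]⟩

/-- **Both homomorphisms of a domination `s ≫ π = [N]_A`, `N ≠ 0`, of a POSITIVE-dimensional `A` are non-zero**
(`[N]_A ≠ 0`: `Hom` is torsion-free and `𝟙_A ≠ 0`). [cite: MumfordAV1970, §19 Thm. 3 and Remark p. 169] -/
theorem ne_zero_of_comp_eq_nsmul_id {A P : AbelianVariety ℂ} {s : A ⟶ P} {π : P ⟶ A} {N : ℕ} (hN : N ≠ 0)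
    (hsπ : s ≫ π = N • 𝟙 A) (h0 : 0 < A.dim) : s ≠ 0 ∧ π ≠ 0 := by
  refine ⟨fun hs => ?_, fun hπ => ?_⟩
  · rw [hs, zero_comp] at hsπ
    exact id_ne_zero_of_dim_pos h0 (hom_eq_zero_of_nsmul_eq_zero hN hsπ.symm)
  · rw [hπ, comp_zero] at hsπ
    exact id_ne_zero_of_dim_pos h0 (hom_eq_zero_of_nsmul_eq_zero hN hsπ.symm)

/-- **Uniqueness of the simple isogeny factors** (Mumford §19 Cor. 1, the part used here): a SIMPLE abelian variety
of positive dimension which is an isogeny factor of a product `⨁_j F_j` of SIMPLE abelian varieties is isogenous to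
some `F_j` (some component `S → F_j` of the section is non-zero, hence an isogeny).
[cite: MumfordAV1970, §19 Thm. 1, Cor. 1–2 (pp. 173–174)] [cite: Milne1999LefschetzClasses, §1 Prop. 1.1] -/
theorem exists_isIsogenous_of_isSimple_of_avDominatedBy_biproduct {J : Type} [Fintype J] {F : J → AbelianVariety ℂ}
    {S : AbelianVariety ℂ} (hF : ∀ j, (F j).IsSimple) (hS : S.IsSimple) (h0 : 0 < S.dim)
    (h : AVDominatedBy S (⨁ F)) : ∃ j, IsIsogenous S (F j) := by
  classical
  obtain ⟨s, π, N, hN, hsπ⟩ := h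
  have hs : s ≠ 0 := (ne_zero_of_comp_eq_nsmul_id hN hsπ h0).1
  have hex : ∃ j, s ≫ biproduct.π F j ≠ 0 := by
    by_contra hall
    push Not at hall
    exact hs (biproduct.hom_ext _ _ fun j => by rw [hall j, zero_comp])
  obtain ⟨j, hj⟩ := hex
  exact ⟨j, ⟨_, isIsogeny_of_isSimple_of_ne_zero hS (hF j) _ hj⟩⟩

end Factors

/-! ## §3 Case (a): a curve factor whose field embeds in that of a threefold factor forces `D²(X) ≠ B²(X)` -/

section CaseA

variable {X : AbelianVariety ℂ}

/-- **Moonen–Zarhin's case (a) forces an exceptional class in `H⁴` of a CM fourfold.**  Let `X` be a complex abelian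
variety of CM type with `dim X = 4`, `E` an elliptic curve and `T` a simple abelian threefold which are ISOGENY FACTORS of
`X` (`E ≼ X`, `T ≼ X` — for `dim E + dim T = dim X` this is `X ∼ E × T`), with a ring embedding
`End⁰(E) ↪ End⁰(T)` (`E` has CM by `k = End⁰(E)`, `k ↪ End⁰(T)`).  Then `X` carries a rational `(2,2)`-class
OUTSIDE `D²(X) ⊗ ℂ` — a Weil class of `k`: «the Weil classes are really needed … `D²(X) ≠ B²(X)`».  Proof: regroup
`X ∼ ⨁ᵢ A'_{cls i}` (gen 36); `E`, `T` are isogenous to representatives `A'_{cls i}`, `A'_{cls j}` (uniqueness of simple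
factors), whose fields `K'_{cls i} ≅ End⁰ ≅ k` and `K'_{cls j} ≅ End⁰(T)` inherit the embedding; seat b16 gen 37's Weil
fibre puts the class on `⨁ᵢ A'_{cls i}`, and it descends to the isogenous `X` degree by degree.
[cite: MoonenZarhin1999LowDim, Thm. (0.1) (a), (1) and the remark after (4)] [cite: MumfordAV1970, §19 Cor. 1–2] -/
theorem exists_exceptional_two_of_curve_threefold_factors (hcm : IsOfCMType X) (h4 : X.dim = 4)
    {E T : AbelianVariety ℂ} (hE : E.dim = 1) (hT : T.IsSimple) (hT3 : T.dim = 3) (hEX : AVDominatedBy E X)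
    (hTX : AVDominatedBy T X) (e : E.endAlgebra →+* T.endAlgebra) :
    ∃ c : complexBetti X.X (2 * 2), IsRationalClass c ∧ IsOfHodgeType X.dim X.X (2 * 2) 2 2 c ∧
      c ∉ divisorClassesSpan X.X X.dim 2 := by
  classical
  obtain ⟨C, _, K', _, _, _, Φ', A', ι', θ', m, cls, f, hA, hs, hniso, -, hf⟩ :=
    exists_isIsogeny_biproduct_of_isSimple_of_isOfCMType (X := X) (by omega) hcm
  have hXP : AVDominatedBy X (⨁ fun i => A' (cls i)) := AVDominatedBy.of_isIsogeny_hom hf (AVDominatedBy.refl _)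
  have hPX : IsIsogenous (⨁ fun i => A' (cls i)) X := IsIsogenous.symm' ⟨f, hf⟩
  -- `E ∼ A'_{cls i}`, `T ∼ A'_{cls j}`
  obtain ⟨i, hi⟩ := exists_isIsogenous_of_isSimple_of_avDominatedBy_biproduct (F := fun i => A' (cls i))
    (fun i => hs (cls i)) (isSimple_of_dim_le_one (by omega)) (by omega) (hEX.trans hXP)
  obtain ⟨j, hj⟩ := exists_isIsogenous_of_isSimple_of_avDominatedBy_biproduct (F := fun i => A' (cls i))
    (fun i => hs (cls i)) hT (by omega) (hTX.trans hXP)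
  have h1 : (A' (cls i)).dim = 1 := by obtain ⟨g, hg⟩ := hi; rw [← dim_eq_of_isIsogeny hg, hE]
  have h3 : (A' (cls j)).dim = 3 := by obtain ⟨g, hg⟩ := hj; rw [← dim_eq_of_isIsogeny hg, hT3]
  -- the embedding `K'_{cls i} ≅ End⁰(A'_{cls i}) ≅ End⁰(E) ↪ End⁰(T) ≅ End⁰(A'_{cls j}) ≅ K'_{cls j}`
  obtain ⟨eE⟩ := nonempty_ringEquiv_endAlgebra_of_isSimple (hA (cls i)) (hs (cls i))
  obtain ⟨eT⟩ := nonempty_ringEquiv_endAlgebra_of_isSimple (hA (cls j)) (hs (cls j))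
  obtain ⟨uE⟩ := hi.nonempty_endAlgebra_algEquiv
  obtain ⟨uT⟩ := hj.nonempty_endAlgebra_algEquiv
  let e' : K' (cls i) →+* K' (cls j) :=
    eT.symm.toRingHom.comp (uT.toRingEquiv.toRingHom.comp (e.comp (uE.symm.toRingEquiv.toRingHom.comp eE.toRingHom)))
  obtain ⟨c, hcQ, hcH, hcD⟩ := exists_exceptional_two_prod_of_dim_one_dim_three_of_ringHom hA hs hniso cls h1 h3 e'
  by_contra hno
  push Not at hno
  exact hcD (mem_divisorClassesSpan_of_isIsogenous_of_forall hPX 2 (fun c hc hpp => hno c hc hpp) c hcQ hcH)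

/-- **Case (a) ⟹ `X` is NOT divisor-generated** (`B•(X) ≠ D•(X)`, already in degree `2`).
[cite: MoonenZarhin1999LowDim, Thm. (0.1) (a) and (1)] -/
theorem not_isDivisorGenerated_of_curve_threefold_factors (hcm : IsOfCMType X) (h4 : X.dim = 4)
    {E T : AbelianVariety ℂ} (hE : E.dim = 1) (hT : T.IsSimple) (hT3 : T.dim = 3) (hEX : AVDominatedBy E X)
    (hTX : AVDominatedBy T X) (e : E.endAlgebra →+* T.endAlgebra) : ¬ IsDivisorGenerated X := fun hD => by
  obtain ⟨c, hcQ, hcH, hcD⟩ := exists_exceptional_two_of_curve_threefold_factors hcm h4 hE hT hT3 hEX hTX e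
  exact hcD (hD 2 c hcQ hcH)

end CaseA

/-! ## §4 A divisor-generated CM fourfold is stably divisor-generated -/

section Powers

variable {X : AbelianVariety ℂ}

/-- **MASTER FORM — a divisor-generated complex abelian fourfold of CM type is STABLY divisor-generated**
(Moonen–Zarhin (0.1) (4) with (1), CM case; Gordon 7.5 (3) ⟹ (1) with 7.6.1): if `X` is of CM type, `dim X = 4` and
`B•(X) = D•(X)`, then every complex abelian variety `B` DOMINATED by a power `X^{N+1}` (every power, everything
isogenous to a power, every abelian subvariety and every quotient of a power, every product of such) is
divisor-generated.  Proof: regroup `X ∼ ⨁ᵢ A'_{cls i}` with simple, pairwise non-isogenous CM representatives of total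
dimension `≤ 4` (gen 36); `B = D` on `X` excludes an embedded curve field in a sextic slot (else seat b16 gen 37's Weil
fibre gives an exceptional class on `⨁ᵢ A'_{cls i} ≼ X`) and forces an octic slot to be nondegenerate
(`A'_b ≼ X` is divisor-generated; lit-deligne-3's octic criterion); so the family is NONDEGENERATE (file 1), `B = D` on
every `⨁_j A'_{π j}`, and `B ≼ X^{N+1} ≼ ⨁_j A'_{π j}` inherits it. UNCONDITIONAL. [cite: MoonenZarhin1999LowDim, Thm. (0.1) (1) and (4)]
[cite: Gordon1999HodgeAVSurvey, 7.5 and 7.6.1] [cite: Milne1999LefschetzClasses, §1 Prop. 1.1] -/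
theorem isDivisorGenerated_of_avDominatedBy_powSucc_of_isOfCMType_of_dim_four {B : AbelianVariety ℂ}
    (hcm : IsOfCMType X) (h4 : X.dim = 4) (hX : IsDivisorGenerated X) {N : ℕ} (hB : AVDominatedBy B (X.powSucc N)) :
    IsDivisorGenerated B := by
  classical
  obtain ⟨C, _, K', _, _, _, Φ', A', ι', θ', m, cls, f, hA, hs, hniso, hcls, hf⟩ :=
    exists_isIsogeny_biproduct_of_isSimple_of_isOfCMType (X := X) (by omega) hcm
  haveI : Nonempty C := ⟨cls 0⟩
  have hsum : ∑ c, (A' c).dim ≤ 4 := (sum_dim_le_dim_of_isIsogeny_biproduct hcls hf).trans h4.le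
  have hXP : AVDominatedBy X (⨁ fun i => A' (cls i)) := AVDominatedBy.of_isIsogeny_hom hf (AVDominatedBy.refl _)
  have hPX : AVDominatedBy (⨁ fun i => A' (cls i)) X := AVDominatedBy.of_isIsogeny_inv hf (AVDominatedBy.refl _)
  have hP : IsDivisorGenerated (⨁ fun i => A' (cls i)) := isDivisorGenerated_of_avDominatedBy hPX hX
  -- (¬a) on the representatives: an embedded curve field would put an exceptional class on `⨁ᵢ A'_{cls i} ≼ X`
  have hfor : ∀ a b, a ≠ b → (A' a).dim = 1 → (A' b).dim = 3 → IsEmpty (K' a →+* K' b) := by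
    intro a b _ ha hb
    by_contra hne
    rw [not_isEmpty_iff] at hne
    obtain ⟨e⟩ := hne
    obtain ⟨ia, rfl⟩ := hcls a
    obtain ⟨ib, rfl⟩ := hcls b
    obtain ⟨c, hcQ, hcH, hcD⟩ := exists_exceptional_two_prod_of_dim_one_dim_three_of_ringHom hA hs hniso cls ha hb e
    exact hcD (hP 2 c hcQ hcH)
  -- (¬b) on the representatives: an octic slot `A'_b ≼ X` is divisor-generated, hence its type is nondegenerate
  have hoct : ∀ b, (A' b).dim = 4 → IsNondegenerate (Φ' b) := by
    intro b hb
    obtain ⟨ib, rfl⟩ := hcls b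
    obtain ⟨φ₀⟩ : Nonempty (K' (cls ib) →+* ℂ) := inferInstance
    have h8 : Module.finrank ℚ (K' (cls ib)) = 8 := by
      rw [finrank_eq_two_mul_dim_of_isCMTypeRealisation (hA (cls ib)), hb]
    have hDb : IsDivisorGenerated (A' (cls ib)) :=
      isDivisorGenerated_of_avDominatedBy ((avDominatedBy_biproduct_summand (fun i => A' (cls i)) ib).trans hPX) hX
    exact (isDivisorGenerated_iff_isNondegenerate_of_finrank_eq_eight h8 φ₀
      ((isSimple_iff_isPrimitive (hA (cls ib)) φ₀).1 (hs (cls ib))) (hA (cls ib))).1 hDb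
  obtain ⟨n, π, hdom⟩ := exists_avDominatedBy_powSucc_biproduct_slots A' cls hXP N
  refine isDivisorGenerated_of_avDominatedBy (hB.trans hdom) fun p c hcQ hcH => ?_
  rw [← hodgeClassSpan_prod_eq_divisorClassesSpan_of_sum_dim_le_four hA hs hniso hsum hfor hoct π p]
  exact Submodule.subset_span ⟨hcQ, hcH⟩

end Powers

end Literature.AlgebraicGeometry.ComplexMultiplication

end

/-! ## Part 5: CMAbelianFourfoldClassification -/

noncomputable section

open _root_.CategoryTheory _root_.CategoryTheory.Limits NumberField
open scoped BigOperators

namespace Literature.AlgebraicGeometry.ComplexMultiplication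

open Literature.NumberTheory.ComplexMultiplication
open Literature.AlgebraicGeometry.Motives (AbelianVariety)
open Literature.AlgebraicGeometry.Motives.AbelianVariety
open Literature.AlgebraicGeometry.HodgeTheory
open Literature.AlgebraicGeometry.ComplexMultiplication
open Literature.AlgebraicGeometry.Milne1999
open Literature.AlgebraicGeometry.Pohlmann1968
open Literature.AlgebraicGeometry.ComplexMultiplication.Domination
open Literature.AlgebraicGeometry.ComplexMultiplication.CMAtlas (nonempty_ringEquiv_endAlgebra_of_isSimple)

/-! ## §5 The classification: `B = D` iff neither case (a) nor case (b) -/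

section Classification

variable {X : AbelianVariety ℂ}

/-- **A NON-SIMPLE complex abelian fourfold of CM type is divisor-generated — equivalently (§4) all its powers are, and
the Hodge conjecture holds for everything dominated by a power — iff it is NOT in Moonen–Zarhin's case (a)**: there are
no elliptic curve `E` and simple abelian threefold `T`, both isogeny factors of `X`, with `End⁰(E) ↪ End⁰(T)`.
(`S × S′`, `E × E′ × S`, `E² × S`, `E₁ × ⋯ × E₄`, `E × T` with `k ↪̸ K_T`, … are all stably divisor-generated.)
Proof of ⟸: in the regrouping the curve/threefold slots inherit no embedding (their `End⁰` are the fields,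
`Ring2.Atlas.nonempty_ringEquiv_endAlgebra_of_isSimple`, and the slots are isogeny factors of `X`), and an octic slot would make
`X` simple (a non-zero `X → A'_b` between varieties of dimension `4`, `A'_b` simple, is an isogeny); so the family is
nondegenerate (file 1) and `B = D` on `⨁ᵢ A'_{cls i} ≽ X`. [cite: MoonenZarhin1999LowDim, Thm. (0.1) (a), (1), (4)]
[cite: MumfordAV1970, §19 Cor. 1–2] -/
theorem isDivisorGenerated_iff_of_not_isSimple_of_dim_four (hcm : IsOfCMType X) (h4 : X.dim = 4)
    (hns : ¬ X.IsSimple) :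
    IsDivisorGenerated X ↔ ¬ ∃ E T : AbelianVariety ℂ, E.dim = 1 ∧ T.IsSimple ∧ T.dim = 3 ∧
      AVDominatedBy E X ∧ AVDominatedBy T X ∧ Nonempty (E.endAlgebra →+* T.endAlgebra) := by
  classical
  refine ⟨fun hD ⟨E, T, hE, hT, hT3, hEX, hTX, ⟨e⟩⟩ =>
    not_isDivisorGenerated_of_curve_threefold_factors hcm h4 hE hT hT3 hEX hTX e hD, fun hna => ?_⟩
  obtain ⟨C, _, K', _, _, _, Φ', A', ι', θ', m, cls, f, hA, hs, hniso, hcls, hf⟩ :=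
    exists_isIsogeny_biproduct_of_isSimple_of_isOfCMType (X := X) (by omega) hcm
  haveI : Nonempty C := ⟨cls 0⟩
  have hsum : ∑ c, (A' c).dim ≤ 4 := (sum_dim_le_dim_of_isIsogeny_biproduct hcls hf).trans h4.le
  have hXP : AVDominatedBy X (⨁ fun i => A' (cls i)) := AVDominatedBy.of_isIsogeny_hom hf (AVDominatedBy.refl _)
  have hPX : AVDominatedBy (⨁ fun i => A' (cls i)) X := AVDominatedBy.of_isIsogeny_inv hf (AVDominatedBy.refl _)
  have hslot : ∀ i, AVDominatedBy (A' (cls i)) X := fun i =>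
    (avDominatedBy_biproduct_summand (fun i => A' (cls i)) i).trans hPX
  -- (¬a) on the representatives
  have hfor : ∀ a b, a ≠ b → (A' a).dim = 1 → (A' b).dim = 3 → IsEmpty (K' a →+* K' b) := by
    intro a b _ ha hb
    by_contra hne
    rw [not_isEmpty_iff] at hne
    obtain ⟨e⟩ := hne
    obtain ⟨ia, rfl⟩ := hcls a
    obtain ⟨ib, rfl⟩ := hcls b
    obtain ⟨eE⟩ := nonempty_ringEquiv_endAlgebra_of_isSimple (hA (cls ia)) (hs (cls ia))
    obtain ⟨eT⟩ := nonempty_ringEquiv_endAlgebra_of_isSimple (hA (cls ib)) (hs (cls ib))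
    exact hna ⟨A' (cls ia), A' (cls ib), ha, hs (cls ib), hb, hslot ia, hslot ib,
      ⟨eT.toRingHom.comp (e.comp eE.symm.toRingHom)⟩⟩
  -- (¬b) on the representatives: an octic slot would make `X` simple
  have hoct : ∀ b, (A' b).dim = 4 → IsNondegenerate (Φ' b) := by
    intro b hb
    obtain ⟨ib, rfl⟩ := hcls b
    exfalso
    obtain ⟨s, π, N, hN, hsπ⟩ := hslot ib
    have hπ : π ≠ 0 := (ne_zero_of_comp_eq_nsmul_id hN hsπ (by omega)).2
    have hiso : IsIsogeny π := isIsogeny_of_isSimple_of_ne_zero_of_dim_eq π (hs (cls ib)) hπ (by omega)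
    exact hns ((hs (cls ib)).of_isIsogenous (IsIsogenous.symm' ⟨π, hiso⟩))
  refine isDivisorGenerated_of_avDominatedBy hXP fun p c hcQ hcH => ?_
  rw [← hodgeClassSpan_prod_eq_divisorClassesSpan_of_sum_dim_le_four hA hs hniso hsum hfor hoct cls p]
  exact Submodule.subset_span ⟨hcQ, hcH⟩

end Classification

end Literature.AlgebraicGeometry.ComplexMultiplication

end

/-! ## Part 6: CMAbelianFivefoldPowers -/

noncomputable section

open _root_.CategoryTheory _root_.CategoryTheory.Limits NumberField
open scoped BigOperators

namespace Literature.AlgebraicGeometry.ComplexMultiplication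

open Literature.NumberTheory.ComplexMultiplication
open Literature.AlgebraicGeometry.Motives (AbelianVariety)
open Literature.AlgebraicGeometry.Motives.AbelianVariety
open Literature.AlgebraicGeometry.HodgeTheory
open Literature.AlgebraicGeometry.ComplexMultiplication
open Literature.AlgebraicGeometry.Milne1999
open Literature.AlgebraicGeometry.Pohlmann1968
open Literature.AlgebraicGeometry.ComplexMultiplication.Domination
open Literature.AlgebraicGeometry.ComplexMultiplication.CMAtlas (nonempty_ringEquiv_endAlgebra_of_isSimple)

variable {X : AbelianVariety ℂ}

/-! ## §2 The good case: ¬(a⁺) ∧ ¬(b′) ⟹ all powers divisor-generated -/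

section Powers

/-- **MASTER FORM — Moonen–Zarhin (0.2) (4), CM case.**  Let `X` be a complex abelian variety of CM type with
`dim X ≤ 5` such that (¬a⁺) no elliptic curve `E` and simple abelian variety `T` of dimension `3` or `4`, both isogeny
factors of `X`, admit `End⁰(E) ↪ End⁰(T)`, and (¬b′) every simple abelian fourfold isogeny factor of `X` is
divisor-generated.  Then every complex abelian variety `B` DOMINATED by a power `X^{N+1}` is divisor-generated.  Proof:
the regrouping has total dimension `≤ 5` and satisfies the criterion of file F5 — a curve/threefold or curve/fourfold
embedding of fields would give (a⁺) with the representatives as factors (`End⁰ ≅ K`), a degenerate octic slot would be a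
non-divisor-generated simple fourfold factor (octic criterion) — so `B = D` on every `⨁_j A'_{π j} ≽ X^{N+1} ≽ B`.
UNCONDITIONAL. [cite: MoonenZarhin1999LowDim, Thm. (0.2) (4)] [cite: Gordon1999HodgeAVSurvey, 7.5 and 7.6.1]
[cite: Milne1999LefschetzClasses, §1 Prop. 1.1] -/
theorem isDivisorGenerated_of_avDominatedBy_powSucc_of_isOfCMType_of_dim_le_five {B : AbelianVariety ℂ}
    (hcm : IsOfCMType X) (h5 : X.dim ≤ 5)
    (hna : ¬ ∃ E T : AbelianVariety ℂ, E.dim = 1 ∧ T.IsSimple ∧ (T.dim = 3 ∨ T.dim = 4) ∧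
      AVDominatedBy E X ∧ AVDominatedBy T X ∧ Nonempty (E.endAlgebra →+* T.endAlgebra))
    (hnb : ∀ F : AbelianVariety ℂ, F.IsSimple → F.dim = 4 → AVDominatedBy F X → IsDivisorGenerated F)
    {N : ℕ} (hB : AVDominatedBy B (X.powSucc N)) : IsDivisorGenerated B := by
  classical
  rcases Nat.eq_zero_or_pos X.dim with h0 | hX0
  · have hdim : ∀ n : ℕ, (X.powSucc n).dim = 0 := by
      intro n
      induction n with
      | zero => exact h0
      | succ n ih => rw [powSucc_succ, dim_prod, ih, h0]
    exact isDivisorGenerated_of_avDominatedBy hB (isDivisorGenerated_of_dim_eq_zero _ (hdim N))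
  obtain ⟨C, _, K', _, _, _, Φ', A', ι', θ', m, cls, f, hA, hs, hniso, hcls, hf⟩ :=
    exists_isIsogeny_biproduct_of_isSimple_of_isOfCMType (X := X) hX0 hcm
  haveI : Nonempty C := ⟨cls 0⟩
  have hsum : ∑ c, (A' c).dim ≤ 5 := (sum_dim_le_dim_of_isIsogeny_biproduct hcls hf).trans h5
  have hXP : AVDominatedBy X (⨁ fun i => A' (cls i)) := AVDominatedBy.of_isIsogeny_hom hf (AVDominatedBy.refl _)
  have hPX : AVDominatedBy (⨁ fun i => A' (cls i)) X := AVDominatedBy.of_isIsogeny_inv hf (AVDominatedBy.refl _)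
  have hslot : ∀ i, AVDominatedBy (A' (cls i)) X := fun i =>
    (avDominatedBy_biproduct_summand (fun i => A' (cls i)) i).trans hPX
  -- (¬a⁺) on the representatives
  have hfor : ∀ a b, a ≠ b → (A' a).dim = 1 → ((A' b).dim = 3 ∨ (A' b).dim = 4) → IsEmpty (K' a →+* K' b) := by
    intro a b _ ha hb
    by_contra hne
    rw [not_isEmpty_iff] at hne
    obtain ⟨e⟩ := hne
    obtain ⟨ia, rfl⟩ := hcls a
    obtain ⟨ib, rfl⟩ := hcls b
    obtain ⟨eE⟩ := nonempty_ringEquiv_endAlgebra_of_isSimple (hA (cls ia)) (hs (cls ia))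
    obtain ⟨eT⟩ := nonempty_ringEquiv_endAlgebra_of_isSimple (hA (cls ib)) (hs (cls ib))
    exact hna ⟨A' (cls ia), A' (cls ib), ha, hs (cls ib), hb, hslot ia, hslot ib,
      ⟨eT.toRingHom.comp (e.comp eE.symm.toRingHom)⟩⟩
  -- (¬b′) on the representatives
  have hoct : ∀ b, (A' b).dim = 4 → IsNondegenerate (Φ' b) := by
    intro b hb
    obtain ⟨ib, rfl⟩ := hcls b
    obtain ⟨φ₀⟩ : Nonempty (K' (cls ib) →+* ℂ) := inferInstance
    have h8 : Module.finrank ℚ (K' (cls ib)) = 8 := by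
      rw [finrank_eq_two_mul_dim_of_isCMTypeRealisation (hA (cls ib)), hb]
    exact (isDivisorGenerated_iff_isNondegenerate_of_finrank_eq_eight h8 φ₀
      ((isSimple_iff_isPrimitive (hA (cls ib)) φ₀).1 (hs (cls ib))) (hA (cls ib))).1
      (hnb _ (hs (cls ib)) hb (hslot ib))
  obtain ⟨n, π, hdom⟩ := exists_avDominatedBy_powSucc_biproduct_slots A' cls hXP N
  refine isDivisorGenerated_of_avDominatedBy (hB.trans hdom) fun p c hcQ hcH => ?_
  rw [← hodgeClassSpan_prod_eq_divisorClassesSpan_of_sum_dim_le_five hA hs hniso hsum hfor hoct π p]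
  exact Submodule.subset_span ⟨hcQ, hcH⟩

end Powers

end Literature.AlgebraicGeometry.ComplexMultiplication

end
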